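import Summits.Ventures.CertifiedManyBodySolver.Observables.StiffnessApexTransportFermiSeaBoxes
import HarnessLib

/-!
# Ventures/CertifiedManyBodySolver — Observables/StiffnessApexTransportBandBoxes.lean

HONEST FRAMING: one-sided certified CEILINGS on the uniform flux stiffness (t–t′ f-sum class) at ANY density, on WHOLE BOXES `[U_a, U_b] × [t′₁, t′₂]` lying in the BAND between the
apex curves of TWO solved sources at ONE station — AREA words — every word CONDITIONAL on the two source rows / row families it names; a ceiling never speaks to the presence of
order; not a `T_c` estimate, not a superconductivity verdict; no number of record. Zero compute, no definition, no claim node, no `sorry`.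

Cell `pub/hubbard-fast` (D-0154 (1)(A) «CERTIFICATE REUSE along parameter paths»), seat `hubbard-fast-reuse-2` g6 (`prover-hubbard-fast-reuse-2-g6-0`), path family «APEX TRANSPORT»,
line «U-AFFINE BOXES», object «BAND BOXES» — the follow-up announced in the companion `Observables/StiffnessApexTransportFermiSeaBoxes.lean` (same seat, same session): there ONE
interacting member × a Fermi-sea row clears to a form AFFINE in `U`; here TWO interacting members at the SAME station `U₁` (slots `s_a < s_b`, affine hopping floors
`α_i + β_iκ` on hopping ranges — the g3 weighted bracket `ObsStiffnessSeqCeilingAt_of_two_apexSources_weighted`, p650211) clear, after multiplying the word inequality by the positive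
`4U(s_b − s_a)(U − U₁)`, to

  `P(U,t) := 4c(s_b − s_a)·U·d + (K_b − 2td)(α_a d + β_a K_a) + (2td − K_a)(α_b d + β_b K_b) ≥ 0`,  `d = U − U₁`, `K_i = Us_i − U₁t`,

which is QUADRATIC in `U` at fixed `t` with the `t`-affine leading coefficient `q(t) = 4c(s_b − s_a) + (s_b − 2t)(α_a + β_a s_a) + (2t − s_a)(α_b + β_b s_b)` (§1). A quadratic on
`[U_a, U_b]` obeys the exact three-term identity `(U_b − U_a)P(U) = (U_b − U)P(U_a) + (U − U_a)P(U_b) − q·(U − U_a)(U_b − U)(U_b − U_a)`; with `w = (U − U_a)(U_b − U) ≤ W = (U_b − U_a)²/4`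
this is a convex combination of the two edge values and of the two edge values LOWERED by `qW` (§2 `quadraticU_nonneg_on_box`). Hence a band box is worded by FOUR `U`-edge families —
`P(U_e,t) ≥ 0` and `P(U_e,t) − q(t)W ≥ 0` for `e = a, b`, each a quadratic in `t` — plus the 24 corner facts (ranges and bracket, affine/bilinear) — §3.

* §1 `ObsStiffnessSeqCeilingAt_of_two_apexSources_affineFloors_oneStation_cleared`; §2 `quadraticU_nonneg_on_box`; §3 `ObsStiffnessSeqCeilingAt_on_box_of_two_apexSources_affineFloors_oneStation`.

NOT said: two DIFFERENT stations clear to a cubic in `U` — not covered; nothing flows toward `U ≤ U₁`; `λ ≠ 0` words are not of this form; no `T > 0`. The ⅞ use: M2∧M3′ σ-chord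
(`s_a = −3/10`) × M4′ own word + t′-chord `K₂` floor (`s_b = −1/5`) at the station `29/5` — the band between the two apex curves (g3 `…_apexBracket29o5_*`, now as AREA words).

References: T. Koma, H. Tasaki, J. Stat. Phys. 76 (1994) 745, §1 [KomaTasaki1994]; D. J. Scalapino, S. R. White, S.-C. Zhang, PRB 47 (1993) 7995, §II [ScalapinoWhiteZhang1993];
T. Hazra, N. Verma, M. Randeria, PRX 9 (2019) 031049, eq. (4) [HazraVermaRanderia2019].
-/

noncomputable section

namespace Summit.Ventures.CertifiedManyBodySolver.Observables

open Literature.MathematicalPhysics.QuantumLattice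
open Literature.MathematicalPhysics.QuantumLattice.ThermodynamicLimit
open Literature.MathematicalPhysics.QuantumFieldTheory
open Literature.Probability.LatticeModels
open Matrix Finset Filter Topology HubbardWave0
open scoped Matrix BigOperators ComplexOrder

/-! ## §1 The cleared point master: two affine-floor members at one station -/

section Cleared

variable {t U n U₁ sa sb : ℝ}

/-- **TWO APEX SOURCES AT ONE STATION, CLEARED.** Station `0 ≤ U₁ < U`, density `0 ≤ n < 2`, slots `s_a < s_b`; member `i ∈ {a, b}` = the torus-limit ground-state class of
`(s_i, U₁, n)` with an AFFINE hopping floor `α_i + β_iκ ≤ e_{Φ(1,κ,0)}(ω)` on `κ ∈ [κlo_i, κhi_i]`. With `d = U − U₁`, `K_i = Us_i − U₁t` (apex hoppings `κ_i = K_i/d`, `κ_b − κ_a = U(s_b − s_a)/d > 0`):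
if the apex hoppings are in range (`κlo_i d ≤ K_i ≤ κhi_i d`), bracket the target (`K_a ≤ 2td ≤ K_b`), and
`0 ≤ 4c(s_b − s_a)Ud + (K_b − 2td)(α_a d + β_a K_a) + (2td − K_a)(α_b d + β_b K_b)`, then `ObsStiffnessSeqCeilingAt t U n c` — the g3 weighted bracket with
`μ_a = (K_b − 2td)/(U(s_b − s_a))`, `μ_b = (2td − K_a)/(U(s_b − s_a))`, denominators cleared. [cite: KomaTasaki1994, §1] [cite: ScalapinoWhiteZhang1993, §II] [cite: HazraVermaRanderia2019, eq. (4)] -/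
theorem ObsStiffnessSeqCeilingAt_of_two_apexSources_affineFloors_oneStation_cleared (hU₁0 : 0 ≤ U₁) (hU₁ : U₁ < U)
    (hn0 : 0 ≤ n) (hn2 : n < 2) (hs : sa < sb) {αa βa κloa κhia αb βb κlob κhib : ℝ}
    (ha : ∀ κ : ℝ, κloa ≤ κ → κ ≤ κhia →
      ∀ (ω : InfVolFermionState 2) (Ls : ℕ → ℕ) (ψ : ∀ L, Fock (Orb (FermionTorus 2 L))),
      Tendsto Ls atTop atTop →
      (∀ j, IsGroundStateInSector (hubbardTorusTT' (Ls j) 1 sa U₁) (rectN n (Ls j)) 0 (ψ (Ls j))) →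
      (∀ j, star (ψ (Ls j)) ⬝ᵥ ψ (Ls j) = 1) → ω.IsTorusLimitOf ψ Ls →
      αa + βa * κ ≤ ω.meanEnergy (hubbardTTPrimeFermionInteraction 1 κ 0) 1)
    (hb : ∀ κ : ℝ, κlob ≤ κ → κ ≤ κhib →
      ∀ (ω : InfVolFermionState 2) (Ls : ℕ → ℕ) (ψ : ∀ L, Fock (Orb (FermionTorus 2 L))),
      Tendsto Ls atTop atTop →
      (∀ j, IsGroundStateInSector (hubbardTorusTT' (Ls j) 1 sb U₁) (rectN n (Ls j)) 0 (ψ (Ls j))) →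
      (∀ j, star (ψ (Ls j)) ⬝ᵥ ψ (Ls j) = 1) → ω.IsTorusLimitOf ψ Ls →
      αb + βb * κ ≤ ω.meanEnergy (hubbardTTPrimeFermionInteraction 1 κ 0) 1)
    (hloa : κloa * (U - U₁) ≤ U * sa - U₁ * t) (hhia : U * sa - U₁ * t ≤ κhia * (U - U₁))
    (hlob : κlob * (U - U₁) ≤ U * sb - U₁ * t) (hhib : U * sb - U₁ * t ≤ κhib * (U - U₁))
    (hbra : U * sa - U₁ * t ≤ 2 * t * (U - U₁)) (hbrb : 2 * t * (U - U₁) ≤ U * sb - U₁ * t) (c : ℚ)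
    (hc : 0 ≤ 4 * ((c : ℚ) : ℝ) * (sb - sa) * U * (U - U₁) +
      ((U * sb - U₁ * t) - 2 * t * (U - U₁)) * (αa * (U - U₁) + βa * (U * sa - U₁ * t)) +
      (2 * t * (U - U₁) - (U * sa - U₁ * t)) * (αb * (U - U₁) + βb * (U * sb - U₁ * t))) :
    ObsStiffnessSeqCeilingAt t U n c := by
  have hd : 0 < U - U₁ := sub_pos.2 hU₁
  have hU0 : 0 < U := hU₁0.trans_lt hU₁
  have hE : 0 < U * (sb - sa) := mul_pos hU0 (sub_pos.2 hs)
  have hκa : (U * sa - U₁ * t) / (U - U₁) * (U - U₁) = U * sa - U₁ * t := div_mul_cancel₀ _ hd.ne'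
  have hκb : (U * sb - U₁ * t) / (U - U₁) * (U - U₁) = U * sb - U₁ * t := div_mul_cancel₀ _ hd.ne'
  refine ObsStiffnessSeqCeilingAt_of_two_apexSources_weighted (s₁ := sa) (U₁ := U₁) (s₂ := sb) (U₂ := U₁) (t'P := t) (UP := U)
    (n := n) hU₁0 hU₁ hU₁0 hU₁ hn0 hn2 (μ₁ := ((U * sb - U₁ * t) - 2 * t * (U - U₁)) / (U * (sb - sa)))
    (μ₂ := (2 * t * (U - U₁) - (U * sa - U₁ * t)) / (U * (sb - sa)))
    (div_nonneg (by linarith) hE.le) (div_nonneg (by linarith) hE.le) ?_ ?_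
    (ha _ (by rw [le_div_iff₀ hd]; exact hloa) (by rw [div_le_iff₀ hd]; exact hhia))
    (hb _ (by rw [le_div_iff₀ hd]; exact hlob) (by rw [div_le_iff₀ hd]; exact hhib)) c ?_
  · rw [← add_div, div_eq_one_iff_eq hE.ne']; ring
  · rw [div_mul_div_comm, div_mul_div_comm, ← add_div, div_eq_iff (mul_ne_zero hE.ne' hd.ne')]; ring
  · have ea : αa + βa * ((U * sa - U₁ * t) / (U - U₁)) = (αa * (U - U₁) + βa * (U * sa - U₁ * t)) / (U - U₁) := by
      rw [eq_div_iff hd.ne', add_mul, mul_assoc, hκa]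
    have eb : αb + βb * ((U * sb - U₁ * t) / (U - U₁)) = (αb * (U - U₁) + βb * (U * sb - U₁ * t)) / (U - U₁) := by
      rw [eq_div_iff hd.ne', add_mul, mul_assoc, hκb]
    rw [ea, eb, div_mul_div_comm, div_mul_div_comm, ← add_div]
    have hEd : 0 < U * (sb - sa) * (U - U₁) := mul_pos hE hd
    have hN : -(4 * ((c : ℚ) : ℝ)) * (U * (sb - sa) * (U - U₁)) ≤
        ((U * sb - U₁ * t) - 2 * t * (U - U₁)) * (αa * (U - U₁) + βa * (U * sa - U₁ * t)) +
          (2 * t * (U - U₁) - (U * sa - U₁ * t)) * (αb * (U - U₁) + βb * (U * sb - U₁ * t)) := by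
      nlinarith [hc]
    have hNE := (le_div_iff₀ hEd).2 hN
    linarith

end Cleared

/-! ## §2 Arithmetic: a quadratic in `U` on an interval from its two end values and the leading coefficient -/

/-- **A quadratic in `U` is `≥ 0` on `[U_a, U_b]` if its two end values and the end values lowered by `qW` are `≥ 0`** (`q` = leading coefficient, `W = (U_b − U_a)²/4`):
from the three-term identity `(U_b − U_a)f(U) = (U_b − U)f(U_a) + (U − U_a)f(U_b) − q(U − U_a)(U_b − U)(U_b − U_a)` and `0 ≤ (U − U_a)(U_b − U) ≤ W`. Stated for the explicit form
`f(U) = qU² + pU + r`. [folklore] -/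
theorem quadraticU_nonneg_on_box {q p r Ua Ub U : ℝ} (hab : Ua < Ub) (hU : U ∈ Set.Icc Ua Ub)
    (ha : 0 ≤ q * Ua ^ 2 + p * Ua + r) (hb : 0 ≤ q * Ub ^ 2 + p * Ub + r)
    (haW : 0 ≤ q * Ua ^ 2 + p * Ua + r - q * ((Ub - Ua) ^ 2 / 4)) (hbW : 0 ≤ q * Ub ^ 2 + p * Ub + r - q * ((Ub - Ua) ^ 2 / 4)) :
    0 ≤ q * U ^ 2 + p * U + r := by
  obtain ⟨hUa, hUb⟩ := hU
  have hw0 : 0 ≤ (U - Ua) * (Ub - U) := mul_nonneg (sub_nonneg.2 hUa) (sub_nonneg.2 hUb)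
  have hwW : (U - Ua) * (Ub - U) ≤ (Ub - Ua) ^ 2 / 4 := by nlinarith [sq_nonneg ((U - Ua) - (Ub - U))]
  have hpos : 0 < (Ub - Ua) ^ 2 / 4 * (Ub - Ua) := mul_pos (by positivity) (sub_pos.2 hab)
  have key : (Ub - Ua) ^ 2 / 4 * (Ub - Ua) * (q * U ^ 2 + p * U + r) =
      ((Ub - Ua) ^ 2 / 4 - (U - Ua) * (Ub - U)) * ((Ub - U) * (q * Ua ^ 2 + p * Ua + r) + (U - Ua) * (q * Ub ^ 2 + p * Ub + r)) +
      (U - Ua) * (Ub - U) * ((Ub - U) * (q * Ua ^ 2 + p * Ua + r - q * ((Ub - Ua) ^ 2 / 4)) +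
        (U - Ua) * (q * Ub ^ 2 + p * Ub + r - q * ((Ub - Ua) ^ 2 / 4))) := by
    ring
  have hnn : 0 ≤ (Ub - Ua) ^ 2 / 4 * (Ub - Ua) * (q * U ^ 2 + p * U + r) := by
    rw [key]
    have h1 := add_nonneg (mul_nonneg (sub_nonneg.2 hUb) ha) (mul_nonneg (sub_nonneg.2 hUa) hb)
    have h2 := add_nonneg (mul_nonneg (sub_nonneg.2 hUb) haW) (mul_nonneg (sub_nonneg.2 hUa) hbW)
    exact add_nonneg (mul_nonneg (sub_nonneg.2 hwW) h1) (mul_nonneg hw0 h2)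
  exact (mul_nonneg_iff_of_pos_left hpos).1 hnn

/-! ## §3 THE BAND BOX THEOREM: four `U`-edge families + 24 corners word the whole box -/

section Box

variable {n U₁ sa sb : ℝ}

/-- **BAND BOX WORD (two members at one station).** Station `0 ≤ U₁`, slots `s_a < s_b`, members with affine hopping floors on hopping ranges (§1); a box `U₁ < U_a < U_b`, `t₁ < t₂`;
at the four corners: both apex hoppings in range and bracketing the target (24 affine/bilinear facts); on the two `U`-edges, for every `t ∈ [t₁, t₂]`: `0 ≤ P(U_e,t)` and
`0 ≤ P(U_e,t) − q(t)·(U_b − U_a)²/4`, where `P` is the cleared word of §1 and `q(t) = 4c(s_b − s_a) + (s_b − 2t)(α_a + β_a s_a) + (2t − s_a)(α_b + β_b s_b)` its leading coefficient in `U`.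
Then `ObsStiffnessSeqCeilingAt t U n c` at EVERY point of the box (§2 applied to `P(·,t)`, then §1). [cite: KomaTasaki1994, §1] [cite: ScalapinoWhiteZhang1993, §II] [cite: HazraVermaRanderia2019, eq. (4)] -/
theorem ObsStiffnessSeqCeilingAt_on_box_of_two_apexSources_affineFloors_oneStation (hU₁0 : 0 ≤ U₁)
    (hn0 : 0 ≤ n) (hn2 : n < 2) (hs : sa < sb) {αa βa κloa κhia αb βb κlob κhib : ℝ}
    (ha : ∀ κ : ℝ, κloa ≤ κ → κ ≤ κhia →
      ∀ (ω : InfVolFermionState 2) (Ls : ℕ → ℕ) (ψ : ∀ L, Fock (Orb (FermionTorus 2 L))),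
      Tendsto Ls atTop atTop →
      (∀ j, IsGroundStateInSector (hubbardTorusTT' (Ls j) 1 sa U₁) (rectN n (Ls j)) 0 (ψ (Ls j))) →
      (∀ j, star (ψ (Ls j)) ⬝ᵥ ψ (Ls j) = 1) → ω.IsTorusLimitOf ψ Ls →
      αa + βa * κ ≤ ω.meanEnergy (hubbardTTPrimeFermionInteraction 1 κ 0) 1)
    (hb : ∀ κ : ℝ, κlob ≤ κ → κ ≤ κhib →
      ∀ (ω : InfVolFermionState 2) (Ls : ℕ → ℕ) (ψ : ∀ L, Fock (Orb (FermionTorus 2 L))),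
      Tendsto Ls atTop atTop →
      (∀ j, IsGroundStateInSector (hubbardTorusTT' (Ls j) 1 sb U₁) (rectN n (Ls j)) 0 (ψ (Ls j))) →
      (∀ j, star (ψ (Ls j)) ⬝ᵥ ψ (Ls j) = 1) → ω.IsTorusLimitOf ψ Ls →
      αb + βb * κ ≤ ω.meanEnergy (hubbardTTPrimeFermionInteraction 1 κ 0) 1)
    {Ua Ub t₁ t₂ : ℝ} (hUa : U₁ < Ua) (hab : Ua < Ub) (h12 : t₁ < t₂)
    (hloa₁ : κloa * (Ua - U₁) ≤ Ua * sa - U₁ * t₁) (hloa₂ : κloa * (Ua - U₁) ≤ Ua * sa - U₁ * t₂)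
    (hloa₃ : κloa * (Ub - U₁) ≤ Ub * sa - U₁ * t₁) (hloa₄ : κloa * (Ub - U₁) ≤ Ub * sa - U₁ * t₂)
    (hhia₁ : Ua * sa - U₁ * t₁ ≤ κhia * (Ua - U₁)) (hhia₂ : Ua * sa - U₁ * t₂ ≤ κhia * (Ua - U₁))
    (hhia₃ : Ub * sa - U₁ * t₁ ≤ κhia * (Ub - U₁)) (hhia₄ : Ub * sa - U₁ * t₂ ≤ κhia * (Ub - U₁))
    (hlob₁ : κlob * (Ua - U₁) ≤ Ua * sb - U₁ * t₁) (hlob₂ : κlob * (Ua - U₁) ≤ Ua * sb - U₁ * t₂)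
    (hlob₃ : κlob * (Ub - U₁) ≤ Ub * sb - U₁ * t₁) (hlob₄ : κlob * (Ub - U₁) ≤ Ub * sb - U₁ * t₂)
    (hhib₁ : Ua * sb - U₁ * t₁ ≤ κhib * (Ua - U₁)) (hhib₂ : Ua * sb - U₁ * t₂ ≤ κhib * (Ua - U₁))
    (hhib₃ : Ub * sb - U₁ * t₁ ≤ κhib * (Ub - U₁)) (hhib₄ : Ub * sb - U₁ * t₂ ≤ κhib * (Ub - U₁))
    (hbra₁ : Ua * sa - U₁ * t₁ ≤ 2 * t₁ * (Ua - U₁)) (hbra₂ : Ua * sa - U₁ * t₂ ≤ 2 * t₂ * (Ua - U₁))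
    (hbra₃ : Ub * sa - U₁ * t₁ ≤ 2 * t₁ * (Ub - U₁)) (hbra₄ : Ub * sa - U₁ * t₂ ≤ 2 * t₂ * (Ub - U₁))
    (hbrb₁ : 2 * t₁ * (Ua - U₁) ≤ Ua * sb - U₁ * t₁) (hbrb₂ : 2 * t₂ * (Ua - U₁) ≤ Ua * sb - U₁ * t₂)
    (hbrb₃ : 2 * t₁ * (Ub - U₁) ≤ Ub * sb - U₁ * t₁) (hbrb₄ : 2 * t₂ * (Ub - U₁) ≤ Ub * sb - U₁ * t₂) (c : ℚ)
    (hPa : ∀ t ∈ Set.Icc t₁ t₂, 0 ≤ 4 * ((c : ℚ) : ℝ) * (sb - sa) * Ua * (Ua - U₁) +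
      ((Ua * sb - U₁ * t) - 2 * t * (Ua - U₁)) * (αa * (Ua - U₁) + βa * (Ua * sa - U₁ * t)) +
      (2 * t * (Ua - U₁) - (Ua * sa - U₁ * t)) * (αb * (Ua - U₁) + βb * (Ua * sb - U₁ * t)))
    (hPb : ∀ t ∈ Set.Icc t₁ t₂, 0 ≤ 4 * ((c : ℚ) : ℝ) * (sb - sa) * Ub * (Ub - U₁) +
      ((Ub * sb - U₁ * t) - 2 * t * (Ub - U₁)) * (αa * (Ub - U₁) + βa * (Ub * sa - U₁ * t)) +
      (2 * t * (Ub - U₁) - (Ub * sa - U₁ * t)) * (αb * (Ub - U₁) + βb * (Ub * sb - U₁ * t)))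
    (hPaW : ∀ t ∈ Set.Icc t₁ t₂, 0 ≤ 4 * ((c : ℚ) : ℝ) * (sb - sa) * Ua * (Ua - U₁) +
      ((Ua * sb - U₁ * t) - 2 * t * (Ua - U₁)) * (αa * (Ua - U₁) + βa * (Ua * sa - U₁ * t)) +
      (2 * t * (Ua - U₁) - (Ua * sa - U₁ * t)) * (αb * (Ua - U₁) + βb * (Ua * sb - U₁ * t)) -
      (4 * ((c : ℚ) : ℝ) * (sb - sa) + (sb - 2 * t) * (αa + βa * sa) + (2 * t - sa) * (αb + βb * sb)) * ((Ub - Ua) ^ 2 / 4))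
    (hPbW : ∀ t ∈ Set.Icc t₁ t₂, 0 ≤ 4 * ((c : ℚ) : ℝ) * (sb - sa) * Ub * (Ub - U₁) +
      ((Ub * sb - U₁ * t) - 2 * t * (Ub - U₁)) * (αa * (Ub - U₁) + βa * (Ub * sa - U₁ * t)) +
      (2 * t * (Ub - U₁) - (Ub * sa - U₁ * t)) * (αb * (Ub - U₁) + βb * (Ub * sb - U₁ * t)) -
      (4 * ((c : ℚ) : ℝ) * (sb - sa) + (sb - 2 * t) * (αa + βa * sa) + (2 * t - sa) * (αb + βb * sb)) * ((Ub - Ua) ^ 2 / 4)) :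
    ∀ U ∈ Set.Icc Ua Ub, ∀ t ∈ Set.Icc t₁ t₂, ObsStiffnessSeqCeilingAt t U n c := by
  intro U hU t ht
  have hUlt : U₁ < U := hUa.trans_le hU.1
  have hloa : κloa * (U - U₁) ≤ U * sa - U₁ * t := by
    have h := bilinear_nonneg_on_box (a := κloa * U₁) (b := sa - κloa) (c := -U₁) (d := 0) hab h12 hU ht
      (by linarith only [hloa₁]) (by linarith only [hloa₂]) (by linarith only [hloa₃]) (by linarith only [hloa₄])
    linarith only [h]
  have hhia : U * sa - U₁ * t ≤ κhia * (U - U₁) := by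
    have h := bilinear_nonneg_on_box (a := -(κhia * U₁)) (b := κhia - sa) (c := U₁) (d := 0) hab h12 hU ht
      (by linarith only [hhia₁]) (by linarith only [hhia₂]) (by linarith only [hhia₃]) (by linarith only [hhia₄])
    linarith only [h]
  have hlob : κlob * (U - U₁) ≤ U * sb - U₁ * t := by
    have h := bilinear_nonneg_on_box (a := κlob * U₁) (b := sb - κlob) (c := -U₁) (d := 0) hab h12 hU ht
      (by linarith only [hlob₁]) (by linarith only [hlob₂]) (by linarith only [hlob₃]) (by linarith only [hlob₄])
    linarith only [h]
  have hhib : U * sb - U₁ * t ≤ κhib * (U - U₁) := by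
    have h := bilinear_nonneg_on_box (a := -(κhib * U₁)) (b := κhib - sb) (c := U₁) (d := 0) hab h12 hU ht
      (by linarith only [hhib₁]) (by linarith only [hhib₂]) (by linarith only [hhib₃]) (by linarith only [hhib₄])
    linarith only [h]
  have hbra : U * sa - U₁ * t ≤ 2 * t * (U - U₁) := by
    have h := bilinear_nonneg_on_box (a := 0) (b := -sa) (c := -U₁) (d := 2) hab h12 hU ht
      (by linarith only [hbra₁]) (by linarith only [hbra₂]) (by linarith only [hbra₃]) (by linarith only [hbra₄])
    linarith only [h]
  have hbrb : 2 * t * (U - U₁) ≤ U * sb - U₁ * t := by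
    have h := bilinear_nonneg_on_box (a := 0) (b := sb) (c := U₁) (d := -2) hab h12 hU ht
      (by linarith only [hbrb₁]) (by linarith only [hbrb₂]) (by linarith only [hbrb₃]) (by linarith only [hbrb₄])
    linarith only [h]
  refine ObsStiffnessSeqCeilingAt_of_two_apexSources_affineFloors_oneStation_cleared hU₁0 hUlt hn0 hn2 hs ha hb hloa hhia
    hlob hhib hbra hbrb c ?_
  -- `P(·, t)` is a quadratic `qU² + pU + r` in `U`; §2 from the four edge facts (each matched by `ring`)
  have h := quadraticU_nonneg_on_box (U := U)
    (q := 4 * ((c : ℚ) : ℝ) * (sb - sa) + (sb - 2 * t) * (αa + βa * sa) + (2 * t - sa) * (αb + βb * sb))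
    (p := -(4 * ((c : ℚ) : ℝ) * (sb - sa) * U₁) - (sb - 2 * t) * (αa * U₁ + βa * U₁ * t) + U₁ * t * (αa + βa * sa)
      - (2 * t - sa) * (αb * U₁ + βb * U₁ * t) - U₁ * t * (αb + βb * sb))
    (r := -(U₁ * t) * (αa * U₁ + βa * U₁ * t) + U₁ * t * (αb * U₁ + βb * U₁ * t))
    hab hU (by convert hPa t ht using 1; ring) (by convert hPb t ht using 1; ring)
    (by convert hPaW t ht using 1; ring) (by convert hPbW t ht using 1; ring)
  convert h using 1
  ring

end Box

end Summit.Ventures.CertifiedManyBodySolver.Observables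

end
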